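import Literature.MathematicalPhysics.QuantumChemistry.SubsystemSlices
import Literature.MathematicalPhysics.QuantumChemistry.DualConeLowerBound
import Literature.MathematicalPhysics.QuantumLattice.HubbardBondAlgebra
import HarnessLib

/-!
# Subsystem constraints resolved by spin sector: the `(N_α, N_β)` refinement of the
# fractional-`N̄` subsystem bound of Verstichel et al. (2010), and its operator form

Topic `Literature/MathematicalPhysics/QuantumChemistry`. HONEST FRAMING: certified bounds for a
stated model Hamiltonian in a stated basis; not a claim about the real molecule or material beyond
that model — this file is a THEOREM about the finite-basis second-quantised Hamiltonian of the tree
and certifies no number. WHAT THIS FILE IS NOT: not a statement about any semidefinite programme's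
optimum, not a size-consistency proof for any relaxation, not a claim about atoms-in-molecules
charges or spins.

Companion of `SubsystemSlices.lean`, `FractionalNRepresentability.lean`, `SubsystemConstraints.lean`
which vendor B. Verstichel, H. van Aggelen, D. Van Neck, P. W. Ayers, P. Bultinck,
*Subsystem constraints in variational second order density matrix optimization: Curing the
dissociative behavior*, J. Chem. Phys. 132 (2010) 114113 (arXiv:0910.4094; held, pp. 4–7 opened
2026-08-26) §2.2–2.3 as printed: the restriction `(ρ^sub, Γ^sub)` of an ensemble `N`-representable
pair to a subset of the spin orbitals is fractional-`N̄` ensemble representable (eqs. (13)–(23)),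
hence "`Tr(t^sub ρ^sub) + Tr(V^sub Γ^sub) ≥ E^{N̄}` [`≥ E^{N̄}_{SDP}`] with `N̄ = Σ_a ρ^sub_{aa}`, for
any Hamiltonian `(t^sub, V^sub)` defined in the subspace" (eq. (24), with eq. (12)
`E(ρ, Γ) ≥ E^{N̄}_0 ≥ E^{N̄}_{SDP}`), `E^{N̄}` the ensemble energy at fractional TOTAL particle number.
That file lists under "NOT here: the `S_z`-sector refinement of the slicing". THIS file proves that
refinement, for SPIN-COMPATIBLE subsystems — a set of spatial orbitals `φ : Λ ↪o Λ'` of the working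
basis, spin orbitals embedded by `e = orbEmb φ : Orb Λ ↪o Orb Λ'` (the subset case of §2.3; the
basis-independent subspace form, §2.3 after eq. (24), is an orbital rotation away) — together with
the OPERATOR-side identities the companion files route around through reduced-density-matrix sums:

* `jwEmbed_orbEmb_molecularHamiltonian_eq`: the sub-Hamiltonian `Ĥ_sub = Ĥ(h, g, c)` "defined in
  the subspace" acts on the full Fock space as `jwEmbed e Ĥ_sub = Σ h_pq E_{φp,φq} +
  ½ Σ g_pqrs e_{φp φq φr φs} + c` (eqs. (22)–(23)); `molecularHamiltonian_eq_jwEmbed_of_support`: a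
  full-basis integral table supported on the sub-block IS such an operator (the form `t^A`, `V^A` of
  eq. (26) take in a subsystem-adapted orthonormal basis); `rdmEnergy_submatrix_eq_star_dotProduct_jwEmbed`:
  `E[h,g,c]((¹Dψ)|_sub, (²Dψ)|_sub) = ⟨ψ, (jwEmbed e Ĥ_sub) ψ⟩` (eqs. (13)–(14): `Γ^sub_{ab;cd} =
  Γ^N_{ab;cd}`, `ρ^sub_{ac} = ρ^N_{ac}`); `star_dotProduct_sum_numberOp_mulVec`:
  `⟨ψ, N_σ^sub ψ⟩ = Σ_p ¹D_{φpσ,φpσ}` (`N̄ = N̄_α + N̄_β = Σ_a ρ^sub_aa`).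
* `subsectorWeight φ ψ a b` — the weight `w_ab(ψ) = Σ_{u' : a up / b down SUB-orbitals in u'} |ψ u'|²`
  of the subsystem occupation `(N_α^sub, N_β^sub) = (a, b)` (the ensemble weights `x_i w^j_{i s̄}` of
  eqs. (19)–(21), resolved by spin, `j = a + b`); `Σ_ab w_ab = ‖ψ‖²`, `Σ_ab a·w_ab = ⟨ψ, N_α^sub ψ⟩`,
  `Σ_ab b·w_ab = ⟨ψ, N_β^sub ψ⟩`; `w_ab(ψ) = Σ_K ‖P_ab (V_Kᴴ ψ)‖²` over the slices of `SubsystemSlices`.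
* **`subsystem_sector_constraint`** — eq. (12)+(24) refined: for EVERY vector `ψ` of `𝔉(Orb Λ')`
  (no particle-number or normalisation hypothesis),
  `Σ_{a,b ≤ |Λ|} E₀(Ĥ_sub; a, b) · w_ab(ψ) ≤ Re ⟨ψ, (jwEmbed e Ĥ_sub) ψ⟩`
  with the `(N_α, N_β)`-SECTOR energies `E₀(Ĥ_sub; a, b) = sectorGroundEnergy` of the subsystem —
  finer than the printed total-`N` form since `E₀(Ĥ_sub; a + b) ≤ E₀(Ĥ_sub; a, b)` (the weights also
  fix the fragment's mean SPIN polarisation `N̄_α − N̄_β`, not only its mean charge).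
* **`subsystem_sector_constraint_affine`** — the LINEAR-cut form with two prices: if
  `m + μ_α a + μ_β b ≤ E₀(Ĥ_sub; a, b)` for all `a, b ≤ |Λ|` (exact sector energies or any certified
  lower bounds — "for consistency it is preferable to use the SDP lower bound for the subsystem
  energy", p. 6), then `m ‖ψ‖² + μ_α ⟨ψ, N_α^sub ψ⟩ + μ_β ⟨ψ, N_β^sub ψ⟩ ≤ Re ⟨ψ, (jwEmbed e Ĥ_sub) ψ⟩`;
  `μ_α = μ_β` recovers the affine minorants of the total-`N` form
  (`IsEnsembleNRepresentable.subsystem_constraint_affine` of the companion file).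
* **`IsEnsembleNRepresentable.subsystem_sector_constraint_affine`** — the same cut on ensemble
  `N`-representable pairs `(γ, Γ)` of the full basis: `m + μ_α Re Σ_p γ_{φp↑,φp↑} +
  μ_β Re Σ_p γ_{φp↓,φp↓} ≤ Re E[h, g, c](γ|_sub, Γ|_sub)`, and its registration as a necessary
  condition (`isNecessary_subsystemSectorConstraint`, `isNecessaryInSector_subsystemSectorConstraint`)
  in the arbitrary-condition framework of `DualConeLowerBound.lean`.
* Generic lemmas of independent use (§1): every vector of the spinful Fock space is the sum of its
  `(N_α, N_β)`-sector components (`sum_sum_sectorProj_eq`), different sectors are orthogonal, a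
  sector-preserving quadratic form is block diagonal (`star_dotProduct_mulVec_eq_sum_sum_sectorProj`),
  and the sector Rayleigh–Ritz bound for an ARBITRARY vector
  `Σ_{a,b} E₀(A; a, b) ‖P_ab ψ‖² ≤ Re ⟨ψ, A ψ⟩` (`sum_sectorGroundEnergy_mul_le_re_expect`).

Everything is PROVED (0 sorry, no named fact); one definition (`subsectorWeight`). `TODO(general
form)`: subsets of spin orbitals that are not spin-compatible and general one-body subspaces (the
paper's §2.3 last paragraph / §2.4) — orbital rotation first. Tree search
(`lean search 'subsystem|sectorProj|orbEmb.*molecular'`): the total-`N` subsystem constraint is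
`SubsystemConstraints.lean`; no sector-resolved form, no `jwEmbed`–`molecularHamiltonian` identity;
REUSED: `SubsystemSlices.{conjTranspose_frozenEmbed_mulVec_apply, frozenEmbed_eq_zero_of_not_disjoint,
star_dotProduct_jwEmbed_mulVec}`, `JWEmbed.{pre, combine, rangeF, transSign, sum_filter_env_eq}`,
`orbEmb`, `sectorProj`, `sectorGroundEnergy_mul_le_re_rayleigh`, `molecularHamiltonian_mulVec_mem_szSector`,
`rdmEnergy_sum_smul`, `IsEnsembleNRepresentable`, `IsNecessary`.

## References

* B. Verstichel, H. van Aggelen, D. Van Neck, P. W. Ayers, P. Bultinck, J. Chem. Phys. 132 (2010)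
  114113, §2.2 eqs. (11)–(12), §2.3 eqs. (13)–(24). [VerstichelEtAl2010Subsystem]
* E. H. Lieb, Phys. Rev. Lett. 62 (1989) 1201, proof of Thm 1 and Remark (2) (work sector by sector
  in `(N_↑, N_↓)`). [LiebPRL1989]
* H. Tasaki, *Physics and Mathematics of Quantum Many-Body Systems* (2020), §2.2 (variational
  characterisation of the lowest energy in an invariant subspace), §9.2. [Tasaki2020]
* O. Bratteli, D. W. Robinson, *Operator Algebras and Quantum Statistical Mechanics 2* (1997),
  §5.2.1–5.2.2 (Fock space of a direct sum; isotony of the local CAR algebras). [BratteliRobinsonII1997]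
-/

noncomputable section

namespace Literature.MathematicalPhysics.QuantumChemistry

open Matrix Finset Literature.MathematicalPhysics.QuantumLattice JWEmbed
open scoped ComplexOrder BigOperators symmDiff

/-! ### 1. Sector decomposition of an arbitrary vector of the spinful Fock space -/

section Sectors

variable {Λ : Type*} [LinearOrder Λ] [Fintype Λ]

/-- Every configuration has at most `|Λ|` up-spin orbitals. [folklore] -/
private theorem card_upPart_mem_range (s : Finset (Orb Λ)) :
    (upPart s).card ∈ Finset.range (Fintype.card Λ + 1) :=
  Finset.mem_range.2 (Nat.lt_succ_of_le (Finset.card_le_univ _))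

/-- Every configuration has at most `|Λ|` down-spin orbitals. [folklore] -/
private theorem card_downPart_mem_range (s : Finset (Orb Λ)) :
    (downPart s).card ∈ Finset.range (Fintype.card Λ + 1) :=
  Finset.mem_range.2 (Nat.lt_succ_of_le (Finset.card_le_univ _))

/-- **Every Fock-space vector is the sum of its `(N_α, N_β)`-sector components**,
`ψ = Σ_{a,b ≤ |Λ|} P_{ab} ψ` (no particle-number hypothesis; compare `sum_sectorProj_eq` for an
`N`-particle vector; Lieb (1989), proof of Thm 1: `N_↑`, `N_↓` are conserved and one works sector by
sector). [cite: LiebPRL1989, proof of Theorem 1] -/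
theorem sum_sum_sectorProj_eq (ψ : Fock (Orb Λ)) :
    ∑ a ∈ Finset.range (Fintype.card Λ + 1), ∑ b ∈ Finset.range (Fintype.card Λ + 1),
      sectorProj a b ψ = ψ := by
  funext s
  simp only [Finset.sum_apply, sectorProj_apply]
  rw [Finset.sum_eq_single_of_mem (upPart s).card (card_upPart_mem_range s)]
  · rw [Finset.sum_eq_single_of_mem (downPart s).card (card_downPart_mem_range s)]
    · rw [if_pos ⟨rfl, rfl⟩]
    · intro b _ hb
      rw [if_neg (fun h => hb h.2.symm)]
  · intro a _ ha
    exact Finset.sum_eq_zero fun b _ => if_neg (fun h => ha h.1.symm)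

/-- Vectors of different `(N_↑, N_↓)` sectors are orthogonal (they have disjoint supports in the
occupation basis). Lieb (1989), proof of Thm 1. [cite: LiebPRL1989, proof of Theorem 1] -/
theorem star_dotProduct_eq_zero_of_isInSector_ne {a b a' b' : ℕ} {χ ω : Fock (Orb Λ)}
    (hχ : IsInSector a b χ) (hω : IsInSector a' b' ω) (hne : (a, b) ≠ (a', b')) :
    star χ ⬝ᵥ ω = 0 := by
  rw [dotProduct]
  refine Finset.sum_eq_zero fun s _ => ?_
  rw [Pi.star_apply]
  by_cases hs : (upPart s).card = a ∧ (downPart s).card = b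
  · have hs' : ¬((upPart s).card = a' ∧ (downPart s).card = b') := by
      rintro ⟨h1, h2⟩
      exact hne (by rw [← hs.1, ← hs.2, h1, h2])
    rw [hω s hs', mul_zero]
  · rw [hχ s hs, star_zero, zero_mul]

/-- **Block-diagonality of a sector-preserving quadratic form**: if `A` maps every `(a, b)` sector
into itself then `⟨ψ, A ψ⟩ = Σ_{a,b ≤ |Λ|} ⟨P_{ab} ψ, A P_{ab} ψ⟩` for every vector `ψ` (the form is
block diagonal in the conserved quantum numbers; Lieb (1989) Remark (2)(i), Tasaki (2020) §2.2).
[cite: LiebPRL1989, Remark (2)] -/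
theorem star_dotProduct_mulVec_eq_sum_sum_sectorProj {A : Matrix (Finset (Orb Λ)) (Finset (Orb Λ)) ℂ}
    (hA : ∀ a b (χ : Fock (Orb Λ)), IsInSector a b χ → IsInSector a b (A *ᵥ χ)) (ψ : Fock (Orb Λ)) :
    star ψ ⬝ᵥ A *ᵥ ψ =
      ∑ a ∈ Finset.range (Fintype.card Λ + 1), ∑ b ∈ Finset.range (Fintype.card Λ + 1),
        star (sectorProj a b ψ) ⬝ᵥ A *ᵥ sectorProj a b ψ := by
  conv_lhs => rw [← sum_sum_sectorProj_eq ψ]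
  rw [star_sum, sum_dotProduct]
  refine Finset.sum_congr rfl fun a ha => ?_
  rw [star_sum, sum_dotProduct]
  refine Finset.sum_congr rfl fun b hb => ?_
  rw [mulVec_sum, dotProduct_sum, Finset.sum_eq_single_of_mem a ha]
  · rw [mulVec_sum, dotProduct_sum, Finset.sum_eq_single_of_mem b hb]
    intro b' _ hb'
    exact star_dotProduct_eq_zero_of_isInSector_ne (isInSector_sectorProj a b ψ)
      (hA _ _ _ (isInSector_sectorProj a b' ψ)) (fun h => hb' (congrArg Prod.snd h).symm)
  · intro a' _ ha'
    rw [mulVec_sum, dotProduct_sum]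
    exact Finset.sum_eq_zero fun b' _ =>
      star_dotProduct_eq_zero_of_isInSector_ne (isInSector_sectorProj a b ψ)
        (hA _ _ _ (isInSector_sectorProj a' b' ψ)) (fun h => ha' (congrArg Prod.fst h).symm)

/-- `‖ψ‖² = Σ_{a,b ≤ |Λ|} ‖P_{ab} ψ‖²` (Pythagoras over the sectors). Lieb (1989), proof of Thm 1.
[cite: LiebPRL1989, proof of Theorem 1] -/
theorem star_dotProduct_self_eq_sum_sum_sectorProj (ψ : Fock (Orb Λ)) :
    star ψ ⬝ᵥ ψ =
      ∑ a ∈ Finset.range (Fintype.card Λ + 1), ∑ b ∈ Finset.range (Fintype.card Λ + 1),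
        star (sectorProj a b ψ) ⬝ᵥ sectorProj a b ψ := by
  have h := star_dotProduct_mulVec_eq_sum_sum_sectorProj (A := (1 : Matrix (Finset (Orb Λ)) _ ℂ))
    (fun a b χ hχ => by rwa [one_mulVec]) ψ
  simpa only [one_mulVec] using h

/-- **The sector Rayleigh–Ritz principle for an arbitrary vector**: for a Hermitian `A` mapping
every `(N_α, N_β)` sector into itself and ANY `ψ` (a superposition of sectors),
`Σ_{a,b ≤ |Λ|} E₀(A; a, b) · ‖P_{ab} ψ‖² ≤ Re ⟨ψ, A ψ⟩` — the ensemble variational principle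
`E(ρ, Γ) ≥ E^{N̄}_0 = min Σ_N x_N E^N_0` of Verstichel et al. (2010) eqs. (10)–(12), resolved by
spin sectors (Tasaki (2020) §2.2 sector by sector). [cite: VerstichelEtAl2010Subsystem, §2.2 eqs. (10)-(12)] -/
theorem sum_sectorGroundEnergy_mul_le_re_expect {A : Matrix (Finset (Orb Λ)) (Finset (Orb Λ)) ℂ}
    (hAh : A.IsHermitian)
    (hA : ∀ a b (χ : Fock (Orb Λ)), IsInSector a b χ → IsInSector a b (A *ᵥ χ)) (ψ : Fock (Orb Λ)) :
    ∑ a ∈ Finset.range (Fintype.card Λ + 1), ∑ b ∈ Finset.range (Fintype.card Λ + 1),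
        sectorGroundEnergy A a b * (star (sectorProj a b ψ) ⬝ᵥ sectorProj a b ψ).re ≤
      (star ψ ⬝ᵥ A *ᵥ ψ).re := by
  rw [star_dotProduct_mulVec_eq_sum_sum_sectorProj hA ψ, Complex.re_sum]
  refine Finset.sum_le_sum fun a _ => ?_
  rw [Complex.re_sum]
  exact Finset.sum_le_sum fun b _ =>
    sectorGroundEnergy_mul_le_re_rayleigh hAh (isInSector_sectorProj a b ψ)

/-- The molecular Hamiltonian maps every `(N_α, N_β)` sector into itself (support form of
`molecularHamiltonian_mulVec_mem_szSector`). [cite: HelgakerJorgensenOlsen2000, §2.3.4] -/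
theorem isInSector_molecularHamiltonian_mulVec (h : Λ → Λ → ℂ) (g : Λ → Λ → Λ → Λ → ℂ) (c : ℂ)
    {a b : ℕ} {χ : Fock (Orb Λ)} (hχ : IsInSector a b χ) :
    IsInSector a b (molecularHamiltonian h g c *ᵥ χ) :=
  (mem_szSector_iff_isInSector a b _).1
    (molecularHamiltonian_mulVec_mem_szSector h g c ((mem_szSector_iff_isInSector a b χ).2 hχ))

end Sectors

/-! ### 2. The subsystem: sub-orbitals `φ : Λ ↪o Λ'`, the embedded sub-Hamiltonian, the weights -/

section Subsystem

variable {Λ Λ' : Type*} [LinearOrder Λ] [Fintype Λ] [LinearOrder Λ'] [Fintype Λ']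
variable (φ : Λ ↪o Λ')

/-- `jwEmbed (orbEmb φ)` maps `E_pq` to `E_{φp, φq}`. [cite: BratteliRobinsonII1997, §5.2.2 (isotony of the local CAR algebras)] -/
theorem jwEmbed_orbEmb_singletExcitation (p q : Λ) :
    jwEmbed (orbEmb φ) (singletExcitation p q) = singletExcitation (φ p) (φ q) := by
  simp only [singletExcitation, map_sum, map_mul, jwEmbed_creation, jwEmbed_annihilation, orbEmb_orb]

/-- `jwEmbed (orbEmb φ)` maps `e_pqrs` to `e_{φp φq φr φs}`. [cite: BratteliRobinsonII1997, §5.2.2 (isotony of the local CAR algebras)] -/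
theorem jwEmbed_orbEmb_twoElectronExcitation (p q r s : Λ) :
    jwEmbed (orbEmb φ) (twoElectronExcitation p q r s) =
      twoElectronExcitation (φ p) (φ q) (φ r) (φ s) := by
  simp only [twoElectronExcitation, map_sum, map_mul, jwEmbed_creation, jwEmbed_annihilation,
    orbEmb_orb]

/-- **The sub-Hamiltonian "defined in the subspace", acting on the full Fock space**:
`jwEmbed (orbEmb φ) Ĥ(h, g, c) = Σ_pq h_pq E_{φp,φq} + ½ Σ_pqrs g_pqrs e_{φp φq φr φs} + c · 1`
(Verstichel et al. (2010) eqs. (22)–(23): the operators `t^sub`, `V^sub` of the subspace extended to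
the total single-particle space). [cite: VerstichelEtAl2010Subsystem, §2.3 eqs. (22)-(23)] -/
theorem jwEmbed_orbEmb_molecularHamiltonian_eq (h : Λ → Λ → ℂ) (g : Λ → Λ → Λ → Λ → ℂ) (c : ℂ) :
    jwEmbed (orbEmb φ) (molecularHamiltonian h g c) =
      ∑ p : Λ, ∑ q : Λ, h p q • singletExcitation (φ p) (φ q) +
        (1 / 2 : ℂ) • ∑ p : Λ, ∑ q : Λ, ∑ r : Λ, ∑ s : Λ,
          g p q r s • twoElectronExcitation (φ p) (φ q) (φ r) (φ s) +
        c • (1 : Matrix (Finset (Orb Λ')) (Finset (Orb Λ')) ℂ) := by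
  simp only [molecularHamiltonian, map_add, map_smul, map_sum, map_one,
    jwEmbed_orbEmb_singletExcitation, jwEmbed_orbEmb_twoElectronExcitation]

/-- A sum over the big orbital set of a function vanishing off the image is the sum over the image.
[folklore] -/
private theorem sum_eq_sum_apply_of_eq_zero {M : Type*} [AddCommMonoid M] (f : Λ' → M)
    (hf : ∀ p', p' ∉ Set.range φ → f p' = 0) : ∑ p', f p' = ∑ p, f (φ p) := by
  rw [← Finset.sum_subset (Finset.subset_univ (Finset.univ.map φ.toEmbedding))
      (fun p' _ hp' => hf p' fun ⟨p, hp⟩ => hp' (Finset.mem_map.2 ⟨p, Finset.mem_univ _, hp⟩)),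
    Finset.sum_map]
  rfl

/-- **Full-basis tables supported on the sub-block**: if `h'`, `g'` vanish whenever an index lies
outside the subsystem orbitals, `Ĥ(h', g', c)` on the full Fock space IS the embedded
sub-Hamiltonian of the pulled-back tables. [cite: VerstichelEtAl2010Subsystem, §2.3 eqs. (22)-(23)] -/
theorem molecularHamiltonian_eq_jwEmbed_of_support {h' : Λ' → Λ' → ℂ} {g' : Λ' → Λ' → Λ' → Λ' → ℂ}
    (c : ℂ) (hh : ∀ p' q', (p' ∉ Set.range φ ∨ q' ∉ Set.range φ) → h' p' q' = 0)
    (hg : ∀ p' q' r' s', (p' ∉ Set.range φ ∨ q' ∉ Set.range φ ∨ r' ∉ Set.range φ ∨ s' ∉ Set.range φ) →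
      g' p' q' r' s' = 0) :
    molecularHamiltonian h' g' c =
      jwEmbed (orbEmb φ) (molecularHamiltonian (fun p q => h' (φ p) (φ q))
        (fun p q r s => g' (φ p) (φ q) (φ r) (φ s)) c) := by
  rw [jwEmbed_orbEmb_molecularHamiltonian_eq, molecularHamiltonian]
  congr 2
  · rw [sum_eq_sum_apply_of_eq_zero φ _ (fun p' hp' => Finset.sum_eq_zero fun q' _ => by
      rw [hh p' q' (Or.inl hp'), zero_smul])]
    refine Finset.sum_congr rfl fun p _ => ?_
    exact sum_eq_sum_apply_of_eq_zero φ _ (fun q' hq' => by rw [hh _ q' (Or.inr hq'), zero_smul])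
  · congr 1
    rw [sum_eq_sum_apply_of_eq_zero φ _ (fun p' hp' => Finset.sum_eq_zero fun q' _ =>
      Finset.sum_eq_zero fun r' _ => Finset.sum_eq_zero fun s' _ => by
        rw [hg p' q' r' s' (Or.inl hp'), zero_smul])]
    refine Finset.sum_congr rfl fun p _ => ?_
    rw [sum_eq_sum_apply_of_eq_zero φ _ (fun q' hq' => Finset.sum_eq_zero fun r' _ =>
      Finset.sum_eq_zero fun s' _ => by rw [hg _ q' r' s' (Or.inr (Or.inl hq')), zero_smul])]
    refine Finset.sum_congr rfl fun q _ => ?_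
    rw [sum_eq_sum_apply_of_eq_zero φ _ (fun r' hr' => Finset.sum_eq_zero fun s' _ => by
      rw [hg _ _ r' s' (Or.inr (Or.inr (Or.inl hr'))), zero_smul])]
    refine Finset.sum_congr rfl fun r _ => ?_
    exact sum_eq_sum_apply_of_eq_zero φ _ (fun s' hs' => by
      rw [hg _ _ _ s' (Or.inr (Or.inr (Or.inr hs'))), zero_smul])

/-- The embedded sub-Hamiltonian is Hermitian when the sub-Hamiltonian is. [cite: BratteliRobinsonII1997, §5.2.2, Thm. 5.2.5] -/
theorem jwEmbed_isHermitian {A : Matrix (Finset (Orb Λ)) (Finset (Orb Λ)) ℂ} (hA : A.IsHermitian) :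
    (jwEmbed (orbEmb φ) A).IsHermitian := by
  rw [Matrix.IsHermitian, ← jwEmbed_conjTranspose, hA.eq]

/-- **The weight of the subsystem occupation `(N_α^sub, N_β^sub) = (a, b)` in `ψ`**:
`w_ab(ψ) = Σ |ψ u'|²` over the configurations `u'` of the full basis containing exactly `a` up-spin
and `b` down-spin SUBSYSTEM orbitals — the total weight `Σ_{i s̄} x_i w^j_{i s̄}` of the `j`-particle
subsystem states in the ensemble of Verstichel et al. (2010) eqs. (19)–(21), resolved by spin
(`j = a + b`). [cite: VerstichelEtAl2010Subsystem, §2.3 eqs. (19)-(21)] -/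
def subsectorWeight (ψ : Fock (Orb Λ')) (a b : ℕ) : ℝ :=
  ∑ u' ∈ (Finset.univ : Finset (Finset (Orb Λ'))).filter
      (fun u' => (upPart (pre (orbEmb φ) u')).card = a ∧ (downPart (pre (orbEmb φ) u')).card = b),
    ‖ψ u'‖ ^ 2

/-- The weights are non-negative (`x_N ≥ 0`, Verstichel et al. (2010) eq. (7)). [cite: VerstichelEtAl2010Subsystem, §2.2 eq. (7)] -/
theorem subsectorWeight_nonneg (ψ : Fock (Orb Λ')) (a b : ℕ) : 0 ≤ subsectorWeight φ ψ a b :=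
  Finset.sum_nonneg fun _ _ => by positivity

/-- `Re ⟨ψ, D ψ⟩ = Σ_{u'} Re(d u') · |ψ u'|²` for a diagonal `D` (bookkeeping). [folklore] -/
private theorem re_star_dotProduct_diagonal_mulVec (d : Finset (Orb Λ') → ℂ) (ψ : Fock (Orb Λ')) :
    (star ψ ⬝ᵥ Matrix.diagonal d *ᵥ ψ).re = ∑ u', (d u').re * ‖ψ u'‖ ^ 2 := by
  rw [dotProduct, Complex.re_sum]
  refine Finset.sum_congr rfl fun u' _ => ?_
  rw [Pi.star_apply, mulVec_diagonal, mul_left_comm, Complex.star_def, Complex.conj_mul',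
    ← Complex.ofReal_pow, Complex.re_mul_ofReal]

/-- Grouping a configuration sum of the full basis by the subsystem occupation `(a, b)`. [folklore] -/
private theorem sum_eq_sum_sum_filter_subsector (F : Finset (Orb Λ') → ℝ) :
    ∑ u', F u' =
      ∑ a ∈ Finset.range (Fintype.card Λ + 1), ∑ b ∈ Finset.range (Fintype.card Λ + 1),
        ∑ u' ∈ (Finset.univ : Finset (Finset (Orb Λ'))).filter
          (fun u' => (upPart (pre (orbEmb φ) u')).card = a ∧ (downPart (pre (orbEmb φ) u')).card = b),
          F u' := by
  set R := Finset.range (Fintype.card Λ + 1) with hR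
  have hmaps : ∀ u' ∈ (Finset.univ : Finset (Finset (Orb Λ'))),
      ((upPart (pre (orbEmb φ) u')).card, (downPart (pre (orbEmb φ) u')).card) ∈ R ×ˢ R :=
    fun u' _ => Finset.mem_product.2 ⟨card_upPart_mem_range _, card_downPart_mem_range _⟩
  rw [← Finset.sum_fiberwise_of_maps_to hmaps, Finset.sum_product]
  refine Finset.sum_congr rfl fun a _ => Finset.sum_congr rfl fun b _ => Finset.sum_congr ?_ fun _ _ => rfl
  ext u'
  simp only [Finset.mem_filter, Finset.mem_univ, true_and, Prod.mk.injEq]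

/-- **The weights sum to `‖ψ‖²`** (`Σ_N x_N = 1` for a unit vector; Verstichel et al. (2010) eq. (21)).
[cite: VerstichelEtAl2010Subsystem, §2.3 eq. (21)] -/
theorem sum_subsectorWeight (ψ : Fock (Orb Λ')) :
    ∑ a ∈ Finset.range (Fintype.card Λ + 1), ∑ b ∈ Finset.range (Fintype.card Λ + 1),
        subsectorWeight φ ψ a b = (star ψ ⬝ᵥ ψ).re := by
  have h := re_star_dotProduct_diagonal_mulVec (fun _ => (1 : ℂ)) ψ
  rw [Matrix.diagonal_one, one_mulVec] at h
  rw [h, sum_eq_sum_sum_filter_subsector φ]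
  simp only [Complex.one_re, one_mul, subsectorWeight]

/-- The subsystem up-number resp. down-number operator `N_σ^sub = Σ_p n_{φp, σ}` is diagonal with
entries the number of `σ`-spin subsystem orbitals of the configuration (`n_{xσ}` is diagonal in
the occupation basis, Tasaki (2020) §9.2). [cite: Tasaki2020, §9.2] -/
theorem sum_numberOp_apply_eq_diagonal (σ : Fin 2) :
    (∑ p : Λ, numberOp (φ p) σ : Matrix (Finset (Orb Λ')) (Finset (Orb Λ')) ℂ) =
      Matrix.diagonal fun u' =>
        (((Finset.univ : Finset Λ).filter fun p => orb p σ ∈ pre (orbEmb φ) u').card : ℂ) := by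
  ext u v
  have h1 : ∀ p : Λ, (numberOp (φ p) σ : Matrix (Finset (Orb Λ')) (Finset (Orb Λ')) ℂ) u v =
      if u = v then (if orb (φ p) σ ∈ u then 1 else 0) else 0 := by
    intro p
    rw [show (numberOp (φ p) σ : Matrix (Finset (Orb Λ')) (Finset (Orb Λ')) ℂ) =
        numberAt (orb (φ p) σ) from rfl,
      Literature.MathematicalPhysics.QuantumLattice.numberAt_eq_diagonal, diagonal_apply]
  rw [Matrix.sum_apply, diagonal_apply]
  simp only [h1]
  split_ifs with huv
  · rw [Finset.card_filter, Nat.cast_sum]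
    refine Finset.sum_congr rfl fun p _ => ?_
    simp only [mem_pre, orbEmb_orb]
    split_ifs <;> simp
  · simp

/-- **First moments of the weights = the subsystem particle numbers**:
`Σ_ab a · w_ab(ψ) = Re ⟨ψ, N_α^sub ψ⟩` (`N̄ = Σ_a ρ^sub_aa = Σ_j j x_j w_j`, Verstichel et al. (2010)
eq. (14) and the line before eq. (24)). [cite: VerstichelEtAl2010Subsystem, §2.3 eq. (14)] -/
theorem sum_mul_subsectorWeight_up (ψ : Fock (Orb Λ')) :
    ∑ a ∈ Finset.range (Fintype.card Λ + 1), ∑ b ∈ Finset.range (Fintype.card Λ + 1),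
        (a : ℝ) * subsectorWeight φ ψ a b =
      (star ψ ⬝ᵥ (∑ p : Λ, numberOp (φ p) 0) *ᵥ ψ).re := by
  rw [sum_numberOp_apply_eq_diagonal φ 0, re_star_dotProduct_diagonal_mulVec,
    sum_eq_sum_sum_filter_subsector φ]
  refine Finset.sum_congr rfl fun a _ => Finset.sum_congr rfl fun b _ => ?_
  rw [subsectorWeight, Finset.mul_sum]
  refine Finset.sum_congr rfl fun u' hu' => ?_
  have ha : (upPart (pre (orbEmb φ) u')).card = a := ((Finset.mem_filter.1 hu').2).1
  rw [Complex.natCast_re]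
  congr 1
  change (a : ℝ) = ((upPart (pre (orbEmb φ) u')).card : ℝ)
  rw [ha]

/-- `Σ_ab b · w_ab(ψ) = Re ⟨ψ, N_β^sub ψ⟩`. [cite: VerstichelEtAl2010Subsystem, §2.3 eq. (14)] -/
theorem sum_mul_subsectorWeight_down (ψ : Fock (Orb Λ')) :
    ∑ a ∈ Finset.range (Fintype.card Λ + 1), ∑ b ∈ Finset.range (Fintype.card Λ + 1),
        (b : ℝ) * subsectorWeight φ ψ a b =
      (star ψ ⬝ᵥ (∑ p : Λ, numberOp (φ p) 1) *ᵥ ψ).re := by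
  rw [sum_numberOp_apply_eq_diagonal φ 1, re_star_dotProduct_diagonal_mulVec,
    sum_eq_sum_sum_filter_subsector φ]
  refine Finset.sum_congr rfl fun a _ => Finset.sum_congr rfl fun b _ => ?_
  rw [subsectorWeight, Finset.mul_sum]
  refine Finset.sum_congr rfl fun u' hu' => ?_
  have hb : (downPart (pre (orbEmb φ) u')).card = b := ((Finset.mem_filter.1 hu').2).2
  rw [Complex.natCast_re]
  congr 1
  change (b : ℝ) = ((downPart (pre (orbEmb φ) u')).card : ℝ)
  rw [hb]

/-- Re-indexing the configurations of the big space by (environment part, image part):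
`Σ_{K ⊆ ι' ∖ e ι} Σ_u F (e u ∪ K) = Σ_{u'} F u'` (bookkeeping). [folklore] -/
private theorem sum_powerset_sum_combine {ι ι' : Type*} [LinearOrder ι] [LinearOrder ι'] [Fintype ι]
    [Fintype ι'] (e : ι ↪o ι') {M : Type*} [AddCommMonoid M] (F : Finset ι' → M) :
    ∑ K ∈ ((rangeF e)ᶜ).powerset, ∑ u : Finset ι, F (combine e u K) = ∑ u', F u' := by
  have hmaps : ∀ u' ∈ (Finset.univ : Finset (Finset ι')), env e u' ∈ ((rangeF e)ᶜ).powerset := by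
    intro u' _
    rw [Finset.mem_powerset]
    intro j hj
    exact Finset.mem_compl.2 (mem_env.1 hj).2
  rw [← Finset.sum_fiberwise_of_maps_to hmaps]
  refine Finset.sum_congr rfl fun K hK => ?_
  rw [sum_filter_env_eq (Finset.disjoint_left.2 fun _ hj h =>
    Finset.mem_compl.1 (Finset.mem_powerset.1 hK hj) h)]

/-- The slice along an environment configuration meeting the image vanishes (bookkeeping;
`frozenEmbed_eq_zero_of_not_disjoint`). [folklore] -/
private theorem sectorProj_slice_eq_zero_of_not_disjoint {K : Finset (Orb Λ')}
    (hK : ¬ Disjoint K (rangeF (orbEmb φ))) (ψ : Fock (Orb Λ')) (a b : ℕ) :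
    sectorProj a b ((frozenEmbed (orbEmb φ) K)ᴴ *ᵥ ψ) = 0 := by
  rw [frozenEmbed_eq_zero_of_not_disjoint (orbEmb φ) hK, conjTranspose_zero, zero_mulVec]
  exact sectorProj_eq_self (IsInSector.zero a b)

/-- **The weights are the sector norms of the slices**:
`w_ab(ψ) = Σ_{K} ‖P_{ab} (V_Kᴴ ψ)‖²`, the sum over all environment configurations `K` of the slices
`V_Kᴴ ψ` of `SubsystemSlices.lean` (Verstichel et al. (2010) eqs. (19)–(21): the norms `w^j_{i s̄}` of
the subsystem states, summed over the environment parts `s̄`; here resolved by spin sector).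
[cite: VerstichelEtAl2010Subsystem, §2.3 eqs. (19)-(21)] -/
theorem sum_re_star_dotProduct_sectorProj_slice (ψ : Fock (Orb Λ')) (a b : ℕ) :
    ∑ K : Finset (Orb Λ'),
        (star (sectorProj a b ((frozenEmbed (orbEmb φ) K)ᴴ *ᵥ ψ)) ⬝ᵥ
          sectorProj a b ((frozenEmbed (orbEmb φ) K)ᴴ *ᵥ ψ)).re =
      subsectorWeight φ ψ a b := by
  set e := orbEmb φ with he
  -- only the environment configurations disjoint from the image contribute
  rw [← Finset.sum_subset (Finset.subset_univ ((rangeF e)ᶜ.powerset)) (fun K _ hK => by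
    have hKd : ¬ Disjoint K (rangeF e) := fun hd => hK (Finset.mem_powerset.2 fun j hj =>
      Finset.mem_compl.2 fun hj' => Finset.disjoint_left.1 hd hj hj')
    rw [sectorProj_slice_eq_zero_of_not_disjoint φ hKd, dotProduct_zero, Complex.zero_re])]
  -- the summand as a function of the recombined configuration
  set F : Finset (Orb Λ') → ℝ := fun u' =>
    if (upPart (pre e u')).card = a ∧ (downPart (pre e u')).card = b then ‖ψ u'‖ ^ 2 else 0 with hF
  have hK : ∀ K ∈ ((rangeF e)ᶜ).powerset,
      (star (sectorProj a b ((frozenEmbed e K)ᴴ *ᵥ ψ)) ⬝ᵥ sectorProj a b ((frozenEmbed e K)ᴴ *ᵥ ψ)).re =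
        ∑ u : Finset (Orb Λ), F (combine e u K) := by
    intro K hK
    have hKd : Disjoint K (rangeF e) := Finset.disjoint_left.2 fun _ hj h =>
      Finset.mem_compl.1 (Finset.mem_powerset.1 hK hj) h
    rw [dotProduct, Complex.re_sum]
    refine Finset.sum_congr rfl fun u _ => ?_
    rw [hF]
    simp only
    rw [pre_combine hKd, Pi.star_apply, sectorProj_apply]
    split_ifs with hu
    · rw [conjTranspose_frozenEmbed_mulVec_apply e hKd, Complex.star_def, Complex.conj_mul',
        ← Complex.ofReal_pow, Complex.ofReal_re, norm_mul]
      have h1 : ‖transSign e K u‖ = 1 := by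
        have h2 : ‖transSign e K u‖ * ‖transSign e K u‖ = 1 := by
          rw [← norm_mul, transSign_mul_transSign, symmDiff_self, Finset.bot_eq_empty, transSign_empty,
            norm_one]
        exact (mul_self_eq_one_iff.1 h2).resolve_right (by have := norm_nonneg (transSign e K u); linarith)
      rw [h1, one_mul]
    · rw [star_zero, zero_mul, Complex.zero_re]
  rw [Finset.sum_congr rfl hK, sum_powerset_sum_combine e F, hF, subsectorWeight, Finset.sum_filter]

/-! ### 3. The subsystem constraints resolved by spin sector -/

/-- **THE SUBSYSTEM CONSTRAINT RESOLVED BY SPIN SECTOR** (the `(N_α, N_β)` refinement of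
Verstichel–van Aggelen–Van Neck–Ayers–Bultinck (2010) eq. (24) read with the exact subsystem
energies, eq. (12); the printed total-`N` form is `IsEnsembleNRepresentable.subsystem_constraint` of
`SubsystemConstraints.lean`). For a spin-compatible subsystem `φ : Λ ↪o Λ'` of the orbital basis,
a Hermitian sub-Hamiltonian `Ĥ_sub = Ĥ(h, g, c)` on the subsystem Fock space and EVERY vector `ψ` of
the full Fock space,
`Σ_{a,b ≤ |Λ|} E₀(Ĥ_sub; a, b) · w_ab(ψ) ≤ Re ⟨ψ, (jwEmbed (orbEmb φ) Ĥ_sub) ψ⟩`,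
where `w_ab(ψ) ≥ 0` are the subsystem-occupation weights (`Σ w = ‖ψ‖²`, first moments
`⟨N_α^sub⟩`, `⟨N_β^sub⟩`): the energy of the restriction of `ψ` to the subsystem is at least the
ensemble ground energy of the subsystem at its (fractional) mean occupation `(N̄_α, N̄_β)`. Printed
(total-`N`) form: "if `Γ^N` is integer-`N` ensemble representable, then
`Tr(t^sub ρ^sub) + Tr(V^sub Γ^sub) ≥ E^{N̄}` [`≥ E^{N̄}_{SDP}`] with `N̄ = Σ_a ρ^sub_aa`, for any
Hamiltonian `(t^sub, V^sub)` defined in the subspace"; delta: STRONGER (sector energies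
`E₀(Ĥ_sub; a, b) ≥ E₀(Ĥ_sub; a + b)`, weights resolved by `(N_α^sub, N_β^sub)`), for spin-compatible
subsets. [cite: VerstichelEtAl2010Subsystem, §2.3 eq. (24)] -/
theorem subsystem_sector_constraint {h : Λ → Λ → ℂ} {g : Λ → Λ → Λ → Λ → ℂ} {c : ℂ}
    (hH : (molecularHamiltonian h g c).IsHermitian) (ψ : Fock (Orb Λ')) :
    ∑ a ∈ Finset.range (Fintype.card Λ + 1), ∑ b ∈ Finset.range (Fintype.card Λ + 1),
        sectorGroundEnergy (molecularHamiltonian h g c) a b * subsectorWeight φ ψ a b ≤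
      (star ψ ⬝ᵥ jwEmbed (orbEmb φ) (molecularHamiltonian h g c) *ᵥ ψ).re := by
  set e := orbEmb φ with he
  set R := Finset.range (Fintype.card Λ + 1) with hR
  set H := molecularHamiltonian h g c with hHdef
  have hsec : ∀ a b (χ : Fock (Orb Λ)), IsInSector a b χ → IsInSector a b (H *ᵥ χ) :=
    fun a b χ hχ => isInSector_molecularHamiltonian_mulVec h g c hχ
  calc ∑ a ∈ R, ∑ b ∈ R, sectorGroundEnergy H a b * subsectorWeight φ ψ a b
      = ∑ a ∈ R, ∑ b ∈ R, ∑ K : Finset (Orb Λ'), sectorGroundEnergy H a b *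
          (star (sectorProj a b ((frozenEmbed e K)ᴴ *ᵥ ψ)) ⬝ᵥ
            sectorProj a b ((frozenEmbed e K)ᴴ *ᵥ ψ)).re := by
        refine Finset.sum_congr rfl fun a _ => Finset.sum_congr rfl fun b _ => ?_
        rw [← Finset.mul_sum, sum_re_star_dotProduct_sectorProj_slice]
    _ = ∑ a ∈ R, ∑ K : Finset (Orb Λ'), ∑ b ∈ R, sectorGroundEnergy H a b *
          (star (sectorProj a b ((frozenEmbed e K)ᴴ *ᵥ ψ)) ⬝ᵥ
            sectorProj a b ((frozenEmbed e K)ᴴ *ᵥ ψ)).re :=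
        Finset.sum_congr rfl fun a _ => Finset.sum_comm
    _ = ∑ K : Finset (Orb Λ'), ∑ a ∈ R, ∑ b ∈ R, sectorGroundEnergy H a b *
          (star (sectorProj a b ((frozenEmbed e K)ᴴ *ᵥ ψ)) ⬝ᵥ
            sectorProj a b ((frozenEmbed e K)ᴴ *ᵥ ψ)).re := Finset.sum_comm
    _ ≤ ∑ K : Finset (Orb Λ'), (star ((frozenEmbed e K)ᴴ *ᵥ ψ) ⬝ᵥ H *ᵥ ((frozenEmbed e K)ᴴ *ᵥ ψ)).re :=
        Finset.sum_le_sum fun K _ => sum_sectorGroundEnergy_mul_le_re_expect hH hsec _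
    _ = (star ψ ⬝ᵥ jwEmbed e H *ᵥ ψ).re := by
        rw [star_dotProduct_jwEmbed_mulVec e, Complex.re_sum]

/-- **THE SECTOR-RESOLVED SUBSYSTEM CONSTRAINT AS A LINEAR CUT** (the form eq. (24)/(26) enters a
semidefinite programme; two prices `μ_α`, `μ_β` instead of one). If the affine function `m + μ_α a + μ_β b` lies below the subsystem energies
`E₀(Ĥ_sub; a, b)` for all `a, b ≤ |Λ|` — a supporting line; in particular any certified LOWER
bounds of the subsystem energies may be used ("for consistency it is preferable to use the SDP lower
bound for the subsystem energy rather than the exact one", p. 6), and for energies convex in the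
particle number the segments of the piecewise-linear `E^{N̄}` of eq. (11) are such lines — then for
every vector `ψ` of the full Fock space
`m ‖ψ‖² + μ_α Re⟨ψ, N_α^sub ψ⟩ + μ_β Re⟨ψ, N_β^sub ψ⟩ ≤ Re ⟨ψ, (jwEmbed (orbEmb φ) Ĥ_sub) ψ⟩`,
`N_σ^sub = Σ_p n_{φp, σ}`. The supremum of the left side over supporting lines is the convex hull of
the subsystem sector energies at `(N̄_α, N̄_β)`; with `μ_α = μ_β` it is the piecewise-linear `E^{N̄}`
of eq. (24) (delta: stronger, as for `subsystem_sector_constraint`).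
[cite: VerstichelEtAl2010Subsystem, §2.3 eq. (24)] -/
theorem subsystem_sector_constraint_affine {h : Λ → Λ → ℂ} {g : Λ → Λ → Λ → Λ → ℂ} {c : ℂ}
    (hH : (molecularHamiltonian h g c).IsHermitian) (ψ : Fock (Orb Λ')) {m μu μd : ℝ}
    (hm : ∀ a b : ℕ, a ≤ Fintype.card Λ → b ≤ Fintype.card Λ →
      m + μu * a + μd * b ≤ sectorGroundEnergy (molecularHamiltonian h g c) a b) :
    m * (star ψ ⬝ᵥ ψ).re + μu * (star ψ ⬝ᵥ (∑ p : Λ, numberOp (φ p) 0) *ᵥ ψ).re +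
        μd * (star ψ ⬝ᵥ (∑ p : Λ, numberOp (φ p) 1) *ᵥ ψ).re ≤
      (star ψ ⬝ᵥ jwEmbed (orbEmb φ) (molecularHamiltonian h g c) *ᵥ ψ).re := by
  refine le_trans ?_ (subsystem_sector_constraint φ hH ψ)
  rw [← sum_subsectorWeight φ ψ, ← sum_mul_subsectorWeight_up φ ψ, ← sum_mul_subsectorWeight_down φ ψ,
    Finset.mul_sum, Finset.mul_sum, Finset.mul_sum, ← Finset.sum_add_distrib, ← Finset.sum_add_distrib]
  refine Finset.sum_le_sum fun a ha => ?_
  rw [Finset.mul_sum, Finset.mul_sum, Finset.mul_sum, ← Finset.sum_add_distrib, ← Finset.sum_add_distrib]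
  refine Finset.sum_le_sum fun b hb => ?_
  rw [← mul_assoc, ← mul_assoc, ← add_mul, ← add_mul]
  exact mul_le_mul_of_nonneg_right
    (hm a b (Nat.le_of_lt_succ (Finset.mem_range.1 ha)) (Nat.le_of_lt_succ (Finset.mem_range.1 hb)))
    (subsectorWeight_nonneg φ ψ a b)

/-! ### 4. The reading on the reduced density matrices (eqs. (13)–(14), (24)) -/

/-- **The expectation of the embedded sub-Hamiltonian is the energy functional of the SUB-BLOCKS
of the reduced density matrices**: `⟨ψ, (jwEmbed (orbEmb φ) Ĥ(h,g,c)) ψ⟩ =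
Σ_pq h_pq Σ_σ ¹D_{φpσ, φqσ} + ½ Σ_pqrs g_pqrs Σ_στ ²D_{(φpσ)(φrτ);(φqσ)(φsτ)} + c ⟨ψ, ψ⟩`
(`Γ^sub_{ab;cd} = Γ^N_{ab;cd}`, `ρ^sub_{ac} = ρ^N_{ac}`, Verstichel et al. (2010) eqs. (13)–(14),
(22)–(23)). [cite: VerstichelEtAl2010Subsystem, §2.3 eqs. (13)-(14)] -/
theorem star_dotProduct_jwEmbed_molecularHamiltonian_mulVec (h : Λ → Λ → ℂ)
    (g : Λ → Λ → Λ → Λ → ℂ) (c : ℂ) (ψ : Fock (Orb Λ')) :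
    star ψ ⬝ᵥ jwEmbed (orbEmb φ) (molecularHamiltonian h g c) *ᵥ ψ =
      ∑ p : Λ, ∑ q : Λ, h p q * ∑ σ : Fin 2, oneRDM ψ (orb (φ p) σ) (orb (φ q) σ) +
        (1 / 2 : ℂ) * ∑ p : Λ, ∑ q : Λ, ∑ r : Λ, ∑ s : Λ,
          g p q r s * ∑ σ : Fin 2, ∑ τ : Fin 2,
            twoRDM ψ (orb (φ p) σ, orb (φ r) τ) (orb (φ q) σ, orb (φ s) τ) +
        c * (star ψ ⬝ᵥ ψ) := by
  rw [jwEmbed_orbEmb_molecularHamiltonian_eq]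
  simp only [add_mulVec, smul_mulVec, Matrix.sum_mulVec, one_mulVec, dotProduct_add, dotProduct_smul,
    dotProduct_sum, smul_eq_mul, Finset.mul_sum, expect_singletExcitation_eq_oneRDM,
    expect_twoElectronExcitation_eq_twoRDM]

/-- **Eq. (13)–(14) + (24), left-hand side**: for a UNIT vector `ψ` of the full Fock space, the
energy functional `E[h, g, c]` (`rdmEnergy`) of the sub-blocks `(¹D ψ)|_sub = (¹D ψ).submatrix e e`,
`(²D ψ)|_sub` of its reduced density matrices is the expectation of the embedded sub-Hamiltonian.
[cite: VerstichelEtAl2010Subsystem, §2.3 eqs. (13)-(14)] -/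
theorem rdmEnergy_submatrix_eq_star_dotProduct_jwEmbed (h : Λ → Λ → ℂ) (g : Λ → Λ → Λ → Λ → ℂ)
    (c : ℂ) {ψ : Fock (Orb Λ')} (hψ1 : star ψ ⬝ᵥ ψ = 1) :
    rdmEnergy h g c ((oneRDM ψ).submatrix (orbEmb φ) (orbEmb φ))
        ((twoRDM ψ).submatrix (Prod.map (orbEmb φ) (orbEmb φ)) (Prod.map (orbEmb φ) (orbEmb φ))) =
      star ψ ⬝ᵥ jwEmbed (orbEmb φ) (molecularHamiltonian h g c) *ᵥ ψ := by
  rw [star_dotProduct_jwEmbed_molecularHamiltonian_mulVec, hψ1, mul_one, rdmEnergy]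
  simp only [Matrix.submatrix_apply, Prod.map_apply, orbEmb_orb]

/-- `⟨ψ, N_σ^sub ψ⟩ = Σ_p ¹D_{φpσ, φpσ}` — the subsystem particle numbers are the traces of the
spin blocks of `ρ^sub` (`N̄ = Σ_a ρ^sub_aa`, Verstichel et al. (2010) after eq. (14)).
[cite: VerstichelEtAl2010Subsystem, §2.3 eq. (14)] -/
theorem star_dotProduct_sum_numberOp_mulVec (σ : Fin 2) (ψ : Fock (Orb Λ')) :
    star ψ ⬝ᵥ (∑ p : Λ, numberOp (φ p) σ) *ᵥ ψ = ∑ p : Λ, oneRDM ψ (orb (φ p) σ) (orb (φ p) σ) := by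
  simp only [numberOp, oneRDM, Matrix.sum_mulVec, dotProduct_sum]

/-- Sub-blocks of a weighted sum of matrices (bookkeeping). [folklore] -/
private theorem submatrix_sum_smul {m n k : Type*} {α : Type*} [Fintype α] (w : α → ℂ)
    (M : α → Matrix m m ℂ) (r : n → m) (s : k → m) :
    (∑ j, w j • M j).submatrix r s = ∑ j, w j • (M j).submatrix r s := by
  ext x y
  simp only [Matrix.submatrix_apply, Matrix.sum_apply, Matrix.smul_apply]

/-- **THE SECTOR-RESOLVED SUBSYSTEM CONSTRAINT ON ENSEMBLE `N`-REPRESENTABLE PAIRS** (Verstichel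
et al. (2010) eq. (24) as a linear inequality on `(γ, Γ)`, refined by spin sector; the printed
total-`N` row is `IsEnsembleNRepresentable.subsystem_constraint_affine`): if `(γ, Γ)` is ensemble `N`-representable on the full
spin-orbital basis `Orb Λ'`, `Ĥ_sub = Ĥ(h, g, c)` is a Hermitian sub-Hamiltonian on the subsystem
`φ : Λ ↪o Λ'`, and `m + μ_α a + μ_β b ≤ E₀(Ĥ_sub; a, b)` for all `a, b ≤ |Λ|` (a supporting line of
the subsystem energies — exact, or certified lower bounds), then
`m + μ_α Re Σ_p γ_{φp↑, φp↑} + μ_β Re Σ_p γ_{φp↓, φp↓} ≤ Re E[h, g, c](γ|_sub, Γ|_sub)` with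
`γ|_sub = γ.submatrix e e`, `Γ|_sub = Γ.submatrix (e × e) (e × e)` — "`Tr(t^sub ρ^sub) + Tr(V^sub Γ^sub)
≥ E^{N̄}` with `N̄ = Σ_a ρ^sub_aa`, for any Hamiltonian `(t^sub, V^sub)` defined in the subspace";
delta: stronger (two prices, sector energies). [cite: VerstichelEtAl2010Subsystem, §2.3 eq. (24)] -/
theorem IsEnsembleNRepresentable.subsystem_sector_constraint_affine {N : ℕ} {γ : Matrix (Orb Λ') (Orb Λ') ℂ}
    {Γ : Matrix (Orb Λ' × Orb Λ') (Orb Λ' × Orb Λ') ℂ} (hγ : IsEnsembleNRepresentable N γ Γ)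
    {h : Λ → Λ → ℂ} {g : Λ → Λ → Λ → Λ → ℂ} {c : ℂ}
    (hH : (molecularHamiltonian h g c).IsHermitian) {m μu μd : ℝ}
    (hm : ∀ a b : ℕ, a ≤ Fintype.card Λ → b ≤ Fintype.card Λ →
      m + μu * a + μd * b ≤ sectorGroundEnergy (molecularHamiltonian h g c) a b) :
    m + μu * (∑ p : Λ, γ (orb (φ p) 0) (orb (φ p) 0)).re +
        μd * (∑ p : Λ, γ (orb (φ p) 1) (orb (φ p) 1)).re ≤
      (rdmEnergy h g c (γ.submatrix (orbEmb φ) (orbEmb φ))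
        (Γ.submatrix (Prod.map (orbEmb φ) (orbEmb φ)) (Prod.map (orbEmb φ) (orbEmb φ)))).re := by
  obtain ⟨k, w, ψ, hw0, hw1, hψ, rfl, rfl⟩ := hγ
  have hw1' : ∑ j, ((w j : ℝ) : ℂ) = 1 := by rw [← Complex.ofReal_sum, hw1, Complex.ofReal_one]
  -- the state-level cut for each member of the ensemble
  have hcut : ∀ j, m + μu * (∑ p : Λ, oneRDM (ψ j) (orb (φ p) 0) (orb (φ p) 0)).re +
      μd * (∑ p : Λ, oneRDM (ψ j) (orb (φ p) 1) (orb (φ p) 1)).re ≤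
        (rdmEnergy h g c ((oneRDM (ψ j)).submatrix (orbEmb φ) (orbEmb φ))
          ((twoRDM (ψ j)).submatrix (Prod.map (orbEmb φ) (orbEmb φ))
            (Prod.map (orbEmb φ) (orbEmb φ)))).re := by
    intro j
    have h1 := Literature.MathematicalPhysics.QuantumChemistry.subsystem_sector_constraint_affine φ hH (ψ j) hm
    rwa [(hψ j).2, Complex.one_re, mul_one, star_dotProduct_sum_numberOp_mulVec,
      star_dotProduct_sum_numberOp_mulVec,
      ← rdmEnergy_submatrix_eq_star_dotProduct_jwEmbed φ h g c (hψ j).2] at h1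
  -- the functional and the traces are affine / linear in the ensemble
  have htr : ∀ σ : Fin 2, (∑ p : Λ, (∑ j, ((w j : ℝ) : ℂ) • oneRDM (ψ j)) (orb (φ p) σ) (orb (φ p) σ)).re =
      ∑ j, w j * (∑ p : Λ, oneRDM (ψ j) (orb (φ p) σ) (orb (φ p) σ)).re := by
    intro σ
    simp only [Matrix.sum_apply, Matrix.smul_apply, smul_eq_mul]
    rw [Finset.sum_comm, Complex.re_sum]
    refine Finset.sum_congr rfl fun j _ => ?_
    rw [← Finset.mul_sum, Complex.re_ofReal_mul]
  rw [submatrix_sum_smul, submatrix_sum_smul, rdmEnergy_sum_smul, hw1', sub_self, zero_mul, add_zero,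
    htr 0, htr 1]
  conv_rhs => rw [Complex.re_sum]
  simp only [Complex.re_ofReal_mul]
  have hm' : m = ∑ j, w j * m := by rw [← Finset.sum_mul, hw1, one_mul]
  rw [hm', Finset.mul_sum, Finset.mul_sum, ← Finset.sum_add_distrib, ← Finset.sum_add_distrib]
  refine Finset.sum_le_sum fun j _ => ?_
  have h2 := mul_le_mul_of_nonneg_left (hcut j) (hw0 j)
  linarith [h2]

/-- The sector-resolved subsystem row is a **necessary condition for `N` electrons** in the
arbitrary-condition framework of `DualConeLowerBound.lean` (`IsNecessary`): it may be appended to any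
necessary condition list of a variational 2-RDM lower-bound computation (one row per spin-compatible
subsystem, sub-Hamiltonian and supporting plane `(m, μ_α, μ_β)` of its sector energies). Verstichel et
al. (2010) §2.3 ("new `N`-representability conditions are needed", eq. (24)); delta: sector-resolved.
[cite: VerstichelEtAl2010Subsystem, §2.3 eq. (24)] -/
theorem isNecessary_subsystemSectorConstraint (N : ℕ) {h : Λ → Λ → ℂ} {g : Λ → Λ → Λ → Λ → ℂ}
    {c : ℂ} (hH : (molecularHamiltonian h g c).IsHermitian) {m μu μd : ℝ}
    (hm : ∀ a b : ℕ, a ≤ Fintype.card Λ → b ≤ Fintype.card Λ →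
      m + μu * a + μd * b ≤ sectorGroundEnergy (molecularHamiltonian h g c) a b) :
    IsNecessary N (fun (γ : Matrix (Orb Λ') (Orb Λ') ℂ) (Γ : Matrix (Orb Λ' × Orb Λ') (Orb Λ' × Orb Λ') ℂ) =>
      m + μu * (∑ p : Λ, γ (orb (φ p) 0) (orb (φ p) 0)).re +
          μd * (∑ p : Λ, γ (orb (φ p) 1) (orb (φ p) 1)).re ≤
        (rdmEnergy h g c (γ.submatrix (orbEmb φ) (orbEmb φ))
          (Γ.submatrix (Prod.map (orbEmb φ) (orbEmb φ)) (Prod.map (orbEmb φ) (orbEmb φ)))).re) :=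
  isNecessary_of_forall_isEnsembleNRepresentable fun _ _ hr =>
    hr.subsystem_sector_constraint_affine φ hH hm

/-- Sector form: the same row is necessary in every `S_z` sector `(N_α, N_β) = (a, b)` of the full
system (`IsNecessaryInSector`) — the form used by sector-resolved variational 2-RDM programmes.
[cite: VerstichelEtAl2010Subsystem, §2.3 eq. (24)] -/
theorem isNecessaryInSector_subsystemSectorConstraint (a b : ℕ) {h : Λ → Λ → ℂ}
    {g : Λ → Λ → Λ → Λ → ℂ} {c : ℂ} (hH : (molecularHamiltonian h g c).IsHermitian) {m μu μd : ℝ}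
    (hm : ∀ a' b' : ℕ, a' ≤ Fintype.card Λ → b' ≤ Fintype.card Λ →
      m + μu * a' + μd * b' ≤ sectorGroundEnergy (molecularHamiltonian h g c) a' b') :
    IsNecessaryInSector a b (fun (γ : Matrix (Orb Λ') (Orb Λ') ℂ)
        (Γ : Matrix (Orb Λ' × Orb Λ') (Orb Λ' × Orb Λ') ℂ) =>
      m + μu * (∑ p : Λ, γ (orb (φ p) 0) (orb (φ p) 0)).re +
          μd * (∑ p : Λ, γ (orb (φ p) 1) (orb (φ p) 1)).re ≤
        (rdmEnergy h g c (γ.submatrix (orbEmb φ) (orbEmb φ))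
          (Γ.submatrix (Prod.map (orbEmb φ) (orbEmb φ)) (Prod.map (orbEmb φ) (orbEmb φ)))).re) :=
  (isNecessary_subsystemSectorConstraint φ (a + b) hH hm).isNecessaryInSector

end Subsystem

end Literature.MathematicalPhysics.QuantumChemistry
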